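import Literature.MathematicalPhysics.QuantumFieldTheory.Balaban1983to89.T3Thm1Carrier
import HarnessLib

/-!
# `Balaban1983to89.T3ExistSplit` — rung R3, crux K1, child «MinimiserStabilityRegPr» (stmt-QuantumFields-19200), stub EXIST: the located gap
# G-K1aR-2 (`InfSixOfEightAt`: a minimiser over the SMALL space (8) minimises over the BIG space (6)) SPLIT into [Balaban1985Variational]
# Prop 7 «at most one critical orbit in (6)» (PRINTED; = LQB's `B11.Prop7Printed` at the carrier `T3Thm1Carrier.varProblem3`, reading R2)
# ∧ ATTAINMENT of the infimum of the Wilson action over (6)(ε₀) (located gap G-K1aR-2′ = the LQB lane's `hattain`, cell DIVERGENCE D-B11-2),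
# and the EXIST stub itself from ATTAINMENT ALONE — compositions PROVED

Cell `ym3-torus` (HUMAN RULING D-0037, YM ladder rung R3), seat `ym3-torus-p1` gen 7 (UV side); cell record HOME/UV3-NODE.md §16.7.  WHAT THIS IS
NOT: nothing of Bałaban's is asserted and no minimiser is constructed; `CritUniqueAt` and `MinSixAttainedAt` are HYPOTHESIS SCHEMAS; what
is PROVED is bookkeeping: uniqueness of (reading-R2-)critical orbits turns a small-space minimiser into a big-space one as soon as the
big-space infimum is attained (the two are then gauge-equivalent, and the Wilson action is gauge invariant), and attainment over (6)(ε₀) at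
runs `K` and `K+1` IS the EXIST stub `HasRegMinimisersPrAt` under the route's prefix.

THE POINT.  The EXIST stub of the item asks that the infimum `minActionRegPr` of the Wilson action over print's space (6)(ε₀) be ATTAINED
(at runs `K` and `K+1`, eventually in `K`, for `θ`-small data).  The tree decomposes it as [7] Thm 1 (8) (`Thm1MinimalIn8At`: a minimiser
over (8), PRINTED) ∧ G-K1aR-2 (`InfSixOfEightAt`: it minimises over (6); printed IN KIND — the expansion (142) on the whole chart — cell
memo §13.2).  Here: (i) **`MinSixAttainedAt L a₀ a₁ B₃`** = located gap **G-K1aR-2′** — for `0 < ε₁ ≤ a₁`, `B₃ε₁ ≤ ε₀ ≤ a₀`, (7)-data `V`,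
`n < K`: SOME `U⋆ ∈ regFibrePr F n K _ ε₀ V` minimises the Wilson action over it (= the hypothesis `hattain` of the LQB lane's
`B10NestedMinimizer.isMinOn_of_exists_min_of_unique_crit`; on the OPEN space (6) not automatic: the infimum could sit at `|U(∂p) − 1| =
ε₀L^{−2k}`); (ii) **`CritUniqueAt L a₀ B₃`** = [Balaban1985Variational] Prop 7, first clause, PRINTED, in reading R2 of `T3Thm1Carrier`
(«critical» ↦ «minimises over print's regular fibre at SOME radius `e > 0`» — a minimiser over the relatively open space (6)(e) is a
critical point of (5) on the constraint manifold, so print's «at most one critical orbit» implies it): any two such configurations in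
(6)(ε₀) over `V` lie on one orbit of the group (4); (iii) **`infSixOfEightAt_of_split`** (PROVED): (i) ∧ (ii) ⇒ `InfSixOfEightAt L a₀ a₁ B₃`
(the (8)-minimiser and `U⋆` are both R2-critical in (6)(ε₀), hence gauge-equivalent, hence of equal action); (iv) **`hasRegMinimisersPrAt_of_attained`**
(PROVED): (i) ALONE ⇒ the EXIST stub under the route's prefix (`ε₁′ = a₀`, `K₀ = 1`, `γ₁` from `T3ThresholdSmallness.exists_forall_θBal_le`);
(v) carrier edges: `critUniqueAt_of_prop7` and `thm1MinimalIn8At_of_prop7` — `B11.Prop7Printed B₃ C₁ (famX L)` gives `CritUniqueAt L a₀ B₃` AND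
Thm 1 (8)'s shape `Thm1MinimalIn8At L a₁′ (O₁C₁B₃)` (its second clause «a minimal orbit in the space (6) with ε₀ = O(1)C₁B₃ε₁», reading R1).
So EXIST = ONE located statement (attainment over (6)(ε₀)); G-K1aR-2 = Prop 7 (PRINTED) + the same attainment.

References: T. Bałaban, CMP 102 (1985) 277–309 [Balaban1985Variational] ((4)–(8) p.278, Thm 1 p.279, Prop 7 p.299, (142) p.299).
-/

noncomputable section

open MeasureTheory Filter Topology
open scoped Matrix.Norms.L2Operator
open Literature.MathematicalPhysics.QuantumFieldTheory.Balaban1983to89.T3ContinuumYM3Torus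
open Literature.MathematicalPhysics.QuantumFieldTheory.Balaban1983to89.T3UnitLawDensityEML (ℰp measurableE_ℰp)
open Literature.MathematicalPhysics.QuantumFieldTheory.Balaban1983to89.T3UnitScaleTilt
open Literature.MathematicalPhysics.QuantumFieldTheory.Balaban1983to89.T3TiltDescent
open Literature.MathematicalPhysics.QuantumFieldTheory.Balaban1983to89.T3CruxEstimates
open Literature.MathematicalPhysics.QuantumFieldTheory.Balaban1983to89.T3ConstrainedMinimiser
open Literature.MathematicalPhysics.QuantumFieldTheory.Balaban1983to89.T3DescentFibreTower
open Literature.MathematicalPhysics.QuantumFieldTheory.Balaban1983to89.T3MinimiserStabilityReduction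
open Literature.MathematicalPhysics.QuantumFieldTheory.Balaban1983to89.T3RegularMinimiser
open Literature.MathematicalPhysics.QuantumFieldTheory.Balaban1983to89.T3PrintedRegularMinimiser
open Literature.MathematicalPhysics.QuantumFieldTheory.Balaban1983to89.T3PrintedRegularMinimiserReduction
open Literature.MathematicalPhysics.QuantumFieldTheory.Balaban1983to89.T3PrintedRegularOrbits (descTransf)
open Literature.MathematicalPhysics.QuantumFieldTheory.Balaban1983to89.T3PrintedMinimiserExistence
open Literature.MathematicalPhysics.QuantumFieldTheory.Balaban1983to89.T3ThresholdSmallness (exists_forall_θBal_le)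
open Literature.MathematicalPhysics.QuantumFieldTheory.Balaban1983to89.T3Thm1Carrier
open Literature.MathematicalPhysics.QuantumFieldTheory.Balaban1983to89.B11 (VarProblem VarProblemX Prop7Printed)
open Literature.MathematicalPhysics.QuantumFieldTheory.Balaban1983to89.Missing

namespace Literature.MathematicalPhysics.QuantumFieldTheory.Balaban1983to89.T3ExistSplit

/-! ## §1 The schemas: Prop 7's uniqueness in reading R2 (PRINTED), attainment over (6)(ε₀) (LOCATED) -/

section Schemas

/-- **[Balaban1985Variational] PROP 7, FIRST CLAUSE, AT GIVEN CONSTANTS, READING R2** (hypothesis schema, never asserted): «for ε₀ ≤ a₀ and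
B₃ε₁ ≤ ε₀ the variational problem (5), (6) has at most one critical orbit» — for `n < K`, `0 < ε₁`, `B₃ε₁ ≤ ε₀ ≤ a₀`, (7)-data `V`: any two
configurations of print's regular fibre (6)(ε₀) over `V` each of which minimises the Wilson action over print's regular fibre at SOME radius
`e > 0` (reading R2 of «critical», `T3Thm1Carrier.varProblem3.IsCritical`) lie on one orbit of the group (4) (`T3Thm1Carrier.SameOrbit`:
`U′ = U^u`, `u↓ = 1`). [cite: Balaban1985Variational, Prop. 7 p.299] -/
def CritUniqueAt (L : ℕ) (a₀ B₃ : ℝ) : Prop :=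
  ∀ F : T3Family, F.L = L → ∀ (n K : ℕ) (hnK : n < K) (ε₁ ε₀ : ℝ), 0 < ε₁ → B₃ * ε₁ ≤ ε₀ → ε₀ ≤ a₀ →
    ∀ V : GaugeField (F.P n) 0 (Matrix.specialUnitaryGroup (Fin 2) ℂ), PlaqSmall ε₁ V →
      ∀ U U' : GaugeField (F.P K) 0 (Matrix.specialUnitaryGroup (Fin 2) ℂ),
        U ∈ regFibrePr F n K hnK.le ε₀ V → (varProblem3 F n K hnK.le).IsCritical V U →
        U' ∈ regFibrePr F n K hnK.le ε₀ V → (varProblem3 F n K hnK.le).IsCritical V U' →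
          SameOrbit F n K hnK.le U U'

/-- **LOCATED GAP G-K1aR-2′ AS A SCHEMA — ATTAINMENT OVER THE BIG SPACE (6)(ε₀)** (hypothesis, never asserted; NOT PRINTED as such): for
`n < K`, `0 < ε₁ ≤ a₁`, `B₃ε₁ ≤ ε₀ ≤ a₀` and (7)-data `V`, the infimum of the Wilson action over print's regular fibre `regFibrePr F n K _ ε₀ V`
is attained at some `U⋆` of that (relatively open) space.  = the hypothesis `hattain` of the LQB lane's `B10NestedMinimizer` (cell DIVERGENCE
D-B11-2: print's «minimal» is proved LOCALLY, (142) p. 299); printed in kind (the expansion (142) with Sect. C's bounds over the whole chart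
(19)–(21) excludes minimising sequences at the edge of (6)). [cite: Balaban1985Variational, Prop. 7 p.299] -/
def MinSixAttainedAt (L : ℕ) (a₀ a₁ B₃ : ℝ) : Prop :=
  ∀ F : T3Family, F.L = L → ∀ (n K : ℕ) (hnK : n < K) (ε₁ ε₀ : ℝ), 0 < ε₁ → ε₁ ≤ a₁ → B₃ * ε₁ ≤ ε₀ → ε₀ ≤ a₀ →
    ∀ V : GaugeField (F.P n) 0 (Matrix.specialUnitaryGroup (Fin 2) ℂ), PlaqSmall ε₁ V →
      ∃ U ∈ regFibrePr F n K hnK.le ε₀ V,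
        IsMinOn (fun W : GaugeField (F.P K) 0 (Matrix.specialUnitaryGroup (Fin 2) ℂ) => wilsonAction4 W) (regFibrePr F n K hnK.le ε₀ V) U

end Schemas

/-! ## §2 G-K1aR-2 ⇐ Prop 7 ∧ attainment; the EXIST stub ⇐ attainment alone (PROVED) -/

section Split

/-- The Wilson action is constant on orbits of the group (4) (`A(U^u) = A(U)`). [cite: Balaban1985Variational, (4)-(5) p.278] -/
theorem wilsonAction4_eq_of_sameOrbit (F : T3Family) {n K : ℕ} (h : n ≤ K) {U U' : GaugeField (F.P K) 0 (Matrix.specialUnitaryGroup (Fin 2) ℂ)}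
    (hUU' : SameOrbit F n K h U U') : wilsonAction4 U' = wilsonAction4 U := by
  obtain ⟨u, -, rfl⟩ := hUU'
  exact T4WilsonGaugeFlatDirection.wilsonAction_gaugeAct 1 u U

/-- A minimiser over print's regular fibre at radius `e > 0` is «critical» in reading R2. [cite: Balaban1985Variational, Thm 1 p.279 («critical orbit»)] -/
theorem isCritical_of_isMinOn (F : T3Family) {n K : ℕ} (h : n ≤ K) {e : ℝ} (he : 0 < e)
    {V : GaugeField (F.P n) 0 (Matrix.specialUnitaryGroup (Fin 2) ℂ)} {U : GaugeField (F.P K) 0 (Matrix.specialUnitaryGroup (Fin 2) ℂ)}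
    (hU : U ∈ regFibrePr F n K h e V)
    (hmin : IsMinOn (fun W : GaugeField (F.P K) 0 (Matrix.specialUnitaryGroup (Fin 2) ℂ) => wilsonAction4 W) (regFibrePr F n K h e V) U) :
    (varProblem3 F n K h).IsCritical V U :=
  ⟨e, he, hU, hmin⟩

/-- **G-K1aR-2 ⇐ [Balaban1985Variational] PROP 7 (uniqueness, reading R2) ∧ G-K1aR-2′ (attainment)** (PROVED): a minimiser `U` over the
small space (8)(B₃ε₁) and a minimiser `U⋆` over the big space (6)(ε₀) are both R2-critical in (6)(ε₀), hence on one orbit, hence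
`A(U) = A(U⋆)` and `U` minimises over (6)(ε₀) too (`B₃ > 0`). [cite: Balaban1985Variational, Prop. 7 p.299] -/
theorem infSixOfEightAt_of_split {L : ℕ} {a₀ a₁ B₃ : ℝ} (hB₃ : 0 < B₃) (huniq : CritUniqueAt L a₀ B₃) (hatt : MinSixAttainedAt L a₀ a₁ B₃) :
    InfSixOfEightAt L a₀ a₁ B₃ := by
  intro F hF n K hnK ε₁ ε₀ hε₁ hε₁a hlo hhi V hV U hU8 hmin8
  obtain ⟨Ustar, hUstar, hminstar⟩ := hatt F hF n K hnK ε₁ ε₀ hε₁ hε₁a hlo hhi V hV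
  have hε₀ : 0 < ε₀ := (mul_pos hB₃ hε₁).trans_le hlo
  have hU6 : U ∈ regFibrePr F n K hnK.le ε₀ V := regFibrePr_mono F hlo V hU8
  have hsame : SameOrbit F n K hnK.le U Ustar :=
    huniq F hF n K hnK ε₁ ε₀ hε₁ hlo hhi V hV U Ustar hU6 (isCritical_of_isMinOn F hnK.le (mul_pos hB₃ hε₁) hU8 hmin8) hUstar
      (isCritical_of_isMinOn F hnK.le hε₀ hUstar hminstar)
  have hA : wilsonAction4 Ustar = wilsonAction4 U := wilsonAction4_eq_of_sameOrbit F hnK.le hsame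
  intro W hW
  show wilsonAction4 U ≤ wilsonAction4 W
  rw [← hA]
  exact hminstar hW

/-- One level: from attainment at radius `ε₁ := θBal(n)` in the window, the minimum of the Wilson action over `regFibrePr F n K _ ε₀ V` is
attained (the `sInf` is realised), for every `θBal(n)`-small `V` and `n < K`. [cite: Balaban1985Variational, Thm 1 p.279 and Prop 7 p.299] -/
theorem exists_minimiser_of_attained {L : ℕ} {a₀ a₁ B₃ : ℝ} (hatt : MinSixAttainedAt L a₀ a₁ B₃) {F : T3Family} (hF : F.L = L)
    {n K : ℕ} (hnK : n < K) {ε₁ ε₀ : ℝ} (hε₁ : 0 < ε₁) (hε₁a : ε₁ ≤ a₁) (hlo : B₃ * ε₁ ≤ ε₀) (hhi : ε₀ ≤ a₀)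
    {V : GaugeField (F.P n) 0 (Matrix.specialUnitaryGroup (Fin 2) ℂ)} (hV : PlaqSmall ε₁ V) :
    ∃ U ∈ regFibrePr F n K hnK.le ε₀ V, wilsonAction4 U = minActionRegPr F n K hnK.le ε₀ V := by
  obtain ⟨U, hU, hmin⟩ := hatt F hF n K hnK ε₁ ε₀ hε₁ hε₁a hlo hhi V hV
  exact ⟨U, hU, minActionRegPr_eq_of_isMinOn F hU hmin⟩

/-- **THE EXIST STUB ⇐ ATTAINMENT ALONE, UNDER THE ROUTE'S PREFIX** (PROVED): `MinSixAttainedAt L a₀ a₁ B₃` (`a₀, a₁, B₃ > 0`) ⇒ `∃ ε₁′ = a₀,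
∀ ε₀ ∈ (0, ε₁′], ∀ m ≥ 2, ∀ b₀ > 0, ∀ p₀, ∃ γ₁ > 0, ∀ F γ, F.L = L → 0 < γ ≤ γ₁ → HasRegMinimisersPrAt F γ b₀ p₀ m ε₀` (`K₀ = 1`; `γ₁` puts
`θBal(i) ≤ min a₁ (ε₀/B₃)` at every height; `m ≥ 2` gives `⌊K/m⌋ < K ≤ K + 1`). [cite: Balaban1985Variational, Thm 1 p.279 and Prop 7 p.299] -/
theorem hasRegMinimisersPrAt_of_attained {L : ℕ} {a₀ a₁ B₃ : ℝ} (ha₀ : 0 < a₀) (ha₁ : 0 < a₁) (hB₃ : 0 < B₃)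
    (hatt : MinSixAttainedAt L a₀ a₁ B₃) :
    ∃ ε₁' : ℝ, 0 < ε₁' ∧ ∀ ε₀ : ℝ, 0 < ε₀ → ε₀ ≤ ε₁' → ∀ m : ℕ, 2 ≤ m → ∀ b₀ p₀ : ℝ, 0 < b₀ →
      ∃ γ₁ : ℝ, 0 < γ₁ ∧ ∀ (F : T3Family) (γ : ℝ), F.L = L → 0 < γ → γ ≤ γ₁ → HasRegMinimisersPrAt F γ b₀ p₀ m ε₀ := by
  refine ⟨a₀, ha₀, fun ε₀ hε₀ hε₀a m hm b₀ p₀ hb => ?_⟩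
  by_cases hL : 1 ≤ L
  · have hσ : 0 < min a₁ (ε₀ / B₃) := lt_min ha₁ (div_pos hε₀ hB₃)
    obtain ⟨γ₁, hγ₁, hθ⟩ := exists_forall_θBal_le hL b₀ p₀ hσ
    refine ⟨min γ₁ 1, lt_min hγ₁ one_pos, fun F γ hF hγ hγle => ?_⟩
    have hγ₁' : γ ≤ γ₁ := hγle.trans (min_le_left _ _)
    have hγ1 : γ ≤ 1 := hγle.trans (min_le_right _ _)
    refine ⟨1, fun K hK V hV => ?_⟩
    have hnK : K / m < K := Nat.div_lt_self (by omega) (by omega)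
    have hnK' : K / m < K + 1 := hnK.trans (Nat.lt_succ_self K)
    have hFL : 1 ≤ F.L := F.hL.2.le
    have hε₁ : 0 < θBal F.L γ b₀ p₀ (K / m) := θBal_pos hFL hγ hγ1 hb p₀ (K / m)
    have hθle : θBal F.L γ b₀ p₀ (K / m) ≤ min a₁ (ε₀ / B₃) := by rw [hF]; exact hθ γ hγ hγ₁' (K / m)
    have hε₁a : θBal F.L γ b₀ p₀ (K / m) ≤ a₁ := hθle.trans (min_le_left _ _)
    have hlo : B₃ * θBal F.L γ b₀ p₀ (K / m) ≤ ε₀ := by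
      have h := mul_le_mul_of_nonneg_left (hθle.trans (min_le_right _ _)) hB₃.le
      rwa [mul_div_cancel₀ _ hB₃.ne'] at h
    exact ⟨exists_minimiser_of_attained hatt hF hnK hε₁ hε₁a hlo hε₀a hV,
      exists_minimiser_of_attained hatt hF hnK' hε₁ hε₁a hlo hε₀a hV⟩
  · refine ⟨1, one_pos, fun F γ hF _ _ => ?_⟩
    exact absurd (hF ▸ F.hL.2.le) hL

/-- `MinSixAttainedAt` is antitone in `a₀`, `a₁` and monotone in `B₃` (only the window shrinks). [cite: Balaban1985Variational, Prop. 7 p.299] -/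
theorem minSixAttainedAt_mono {L : ℕ} {a₀ a₀' a₁ a₁' B₃ B₃' : ℝ} (ha₀ : a₀' ≤ a₀) (ha₁ : a₁' ≤ a₁) (hB : B₃ ≤ B₃')
    (hatt : MinSixAttainedAt L a₀ a₁ B₃) : MinSixAttainedAt L a₀' a₁' B₃' :=
  fun F hF n K hnK ε₁ ε₀ hε₁ hε₁a hlo hhi V hV =>
    hatt F hF n K hnK ε₁ ε₀ hε₁ (hε₁a.trans ha₁) ((mul_le_mul_of_nonneg_right hB hε₁.le).trans hlo) (hhi.trans ha₀) V hV

end Split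

/-! ## §3 Carrier edges: LQB's `B11.Prop7Printed` at `varProblem3` gives the uniqueness schema AND Thm 1 (8)'s shape -/

section Edges

/-- **EDGE — `CritUniqueAt` ⇐ [7] PROP 7 AT THE CARRIERS** (first clause, reading R2). [cite: Balaban1985Variational, Prop. 7 p.299] -/
theorem critUniqueAt_of_prop7 {L : ℕ} {B₃ C₁ : ℝ} (H : Prop7Printed B₃ C₁ (famX L)) : ∃ a₀ : ℝ, 0 < a₀ ∧ CritUniqueAt L a₀ B₃ := by
  obtain ⟨a₀, a₁', O₁, ha₀, -, -, H⟩ := H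
  refine ⟨a₀, ha₀, fun F hF n K hnK ε₁ ε₀ hε₁ hlo hhi V hV U U' hU hUc hU' hU'c => ?_⟩
  have h1 := (H ⟨(F, n, K), hF, hnK⟩ ε₀ ε₁ hε₁ V hV).1 hhi hlo
  exact h1 U U' ((mem_regFibrePr_iff F).mp hU).2 hU.1.1 hUc ((mem_regFibrePr_iff F).mp hU').2 hU'.1.1 hU'c

/-- **EDGE — THM 1 (8)'s SHAPE ⇐ [7] PROP 7 AT THE CARRIERS** (second clause «there exists a minimal orbit in the space (6) with ε₀ =
O(1)C₁B₃ε₁», reading R1): `Thm1MinimalIn8At L a₁′ (O₁C₁B₃)` — Prop 7 «implies Theorem 1 but with worse bounds» (p. 299).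
[cite: Balaban1985Variational, Prop. 7 p.299] -/
theorem thm1MinimalIn8At_of_prop7 {L : ℕ} {B₃ C₁ : ℝ} (H : Prop7Printed B₃ C₁ (famX L)) :
    ∃ a₁' O₁ : ℝ, 0 < a₁' ∧ 0 < O₁ ∧ Thm1MinimalIn8At L a₁' (O₁ * C₁ * B₃) := by
  obtain ⟨a₀, a₁', O₁, -, ha₁', hO₁, H⟩ := H
  refine ⟨a₁', O₁, ha₁', hO₁, fun F hF n K hnK ε₁ hε₁ hε₁a V hV => ?_⟩
  obtain ⟨U, hU⟩ := (H ⟨(F, n, K), hF, hnK⟩ ε₁ ε₁ hε₁ V hV).2 hε₁a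
  exact ⟨U, hU.1, hU.2⟩

/-- `CritUniqueAt` is antitone in `a₀` (only the window shrinks). [cite: Balaban1985Variational, Prop. 7 p.299] -/
theorem critUniqueAt_mono {L : ℕ} {a₀ a₀' B₃ : ℝ} (ha₀ : a₀' ≤ a₀) (h : CritUniqueAt L a₀ B₃) : CritUniqueAt L a₀' B₃ :=
  fun F hF n K hnK ε₁ ε₀ hε₁ hlo hhi V hV U U' hU hUc hU' hU'c =>
    h F hF n K hnK ε₁ ε₀ hε₁ hlo (hhi.trans ha₀) V hV U U' hU hUc hU' hU'c

/-- **G-K1aR-2 FROM LQB's [7] PROP 7 AT THE CARRIERS ∧ ATTAINMENT**: `B11.Prop7Printed B₃ C₁ (famX L)` ∧ `MinSixAttainedAt L a₀ a₁ B₃` ⇒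
`InfSixOfEightAt L (min a₀ a₀′) a₁ B₃` for Prop 7's `a₀′` (`B₃ > 0`). [cite: Balaban1985Variational, Prop. 7 p.299] -/
theorem infSixOfEightAt_of_prop7_of_attained {L : ℕ} {B₃ C₁ a₀ a₁ : ℝ} (hB₃ : 0 < B₃) (H : Prop7Printed B₃ C₁ (famX L))
    (hatt : MinSixAttainedAt L a₀ a₁ B₃) : ∃ a₀' : ℝ, 0 < a₀' ∧ InfSixOfEightAt L (min a₀ a₀') a₁ B₃ := by
  obtain ⟨a₀', ha₀', huniq⟩ := critUniqueAt_of_prop7 H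
  exact ⟨a₀', ha₀', infSixOfEightAt_of_split hB₃ (critUniqueAt_mono (min_le_right _ _) huniq)
    (minSixAttainedAt_mono (min_le_left _ _) le_rfl le_rfl hatt)⟩

end Edges

end Literature.MathematicalPhysics.QuantumFieldTheory.Balaban1983to89.T3ExistSplit

end
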